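import Mathlib
import Summits.NavierStokesRegularity.NavierStokesRegularity.Theorems.SubOnsagerCeilingGapChain
import Summits.NavierStokesRegularity.NavierStokesRegularity.Theorems.SubcriticalEnvelopeForwardSourceTailEnvelopeKPPermLow
import Summits.NavierStokesRegularity.NavierStokesRegularity.Theorems.SubcriticalEnvelopeForwardSourceTailEnvelopeKPFan
import Summits.NavierStokesRegularity.NavierStokesRegularity.Theorems.SubcriticalEnvelopeForwardSourceTailEnvelopeKPTwoCycleWide
import HarnessLib

/-!
# RUNG 10 transported to the architecture classes: uniform KP permutation networks, uniform fan networks and the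
# uniform 2-cycle at EVERY scale ratio `1 + ε₀ ∈ [3/2, 2]`
(helper file for crux stmt-NavierStokesRegularity-27057 `SubOnsagerCeiling.ForwardTailCeilingKP`, `--supports … --as helper`;
LEAD SOC g11; also a rung corner for the sister crux 27130 of LEAD SE ns-senv-p1)

The ratio-agnostic strand transfers of LEAD SE (`kpPerm_shellBound_of_chain` p640129's family, `kpFan_shellBound_of_chain`,
`kpTwoCycle_shellBarrier_of_chain`) take the one-mode chain barrier BY NAME. With RUNG 10 (`dyadicGapRange_shellBarrier`,
`ε₀ ∈ [1/2, 9/16]`, this LEAD, `SubOnsagerCeilingGapChain`) and RUNG 4 (`dyadicLowRange_shellBarrier`, `ε₀ ∈ [9/16, 31/50]`) they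
give the ν-uniform weighted per-shell bound (`θ = 101/200`, `D = 100`) for
* uniform KP PERMUTATION networks `kpPermTable σ c` (`c` constant on `σ`-orbits) at every `ε₀ ∈ [1/2, 1]`
  (`kpPerm_shellBarrier_gapRange`, `kpPermGapWide_shellBarrierAt`, `kpPermGapWide_ceilingAt`),
* uniform KP FAN networks `kpFanTable w` at every `ε₀ ∈ [1/2, 1]` (`kpFan_shellBarrier_gapRange`, `kpFanGapWide_shellBarrierAt`,
  `kpFanGapWide_ceilingAt`),
* the uniform 2-CYCLE `kpTwoCycleTable c c` at every `ε₀ ∈ [1/2, 1]` (previously `[31/50, 1]`: `kpTwoCycle_shellBarrier_lowRange`,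
  `kpTwoCycle_shellBarrier_gapRange`, `kpTwoCycleGapWide_shellBarrierAt`, `kpTwoCycleGapWide_ceilingAt`).
HONEST FRAMING: statements about MODEL lattice ODEs (route SubOnsagerCeiling, rung TL-M2Break); three architecture classes at the scale
ratios `b ∈ [3/2, 2]` only; nothing here bears on Navier–Stokes regularity and no crux or summit is proved.
[cite: BarbatoMorandinRomito2011, §2 Lemma 2.1, §3.2] [cite: Tao2016AveragedNS, §4 (4.5), (4.13)]
-/

noncomputable section

-- the sub-problem namespace `NavierStokesRegularity.NavierStokesRegularity` is the tree's layout (D-0017)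
set_option linter.dupNamespace false

namespace Summit.NavierStokesRegularity.NavierStokesRegularity.Theorems

open Set
open Literature.Analysis.FluidPDE.TaoCascade
open Summit.NavierStokesRegularity.NavierStokesRegularity.Theorems.SubOnsagerCeiling
open Summit.NavierStokesRegularity.NavierStokesRegularity.Theses

/-! ## Uniform KP permutation networks -/

/-- **Uniform KP permutation networks, gap range `ε₀ ∈ [1/2, 9/16]`**: the ν-uniform weighted per-shell bound (`θ = 101/200`,
`D = 100`), by the strand transfer applied to RUNG 10 `dyadicGapRange_shellBarrier` (BY NAME). MODEL lattice statement.
[cite: BarbatoMorandinRomito2011, §3.2] -/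
theorem kpPerm_shellBarrier_gapRange {σ : Equiv.Perm (Fin 4)} {c : Fin 4 → ℝ} {ε₀ : ℝ}
    (hcyc : ∀ a, c (σ a) = c a) (hc : ∀ a, 0 ≤ c a) (hε : (1 : ℝ) / 2 ≤ ε₀)
    (hε1 : ε₀ ≤ (9 : ℝ) / 16) :
    ∀ ν : ℝ, 0 < ν → ∀ (X₀ : Fin 4 → ℝ) (s : ℝ), 0 < s → ∀ X : Fin 4 → ℤ → ℝ → ℝ,
      (∀ (i : Fin 4) (k : ℤ), X i k 0 = if k = 0 then X₀ i else 0) →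
      (∀ (i : Fin 4) (k : ℤ), k < 0 → ∀ t : ℝ, X i k t = 0) →
      (∃ M : ℝ, ∀ (t : ℝ) (i : Fin 4) (k : ℤ), (1 + (1 + ε₀) ^ ((10 : ℝ) * k)) * |X i k t| ≤ M) →
      (∀ (i : Fin 4) (k : ℤ), Continuous (X i k)) →
      (∀ (i : Fin 4) (k : ℤ), ∀ t ∈ Set.Icc (0 : ℝ) s, HasDerivWithinAt (X i k)
        (quadTerm ε₀ (kpPermTable σ c) X i k t - ν * (1 + ε₀) ^ ((2 : ℝ) * k) * X i k t)
        (Set.Icc (0 : ℝ) s) t) →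
      (∀ t ∈ Set.Icc (0 : ℝ) s, ∀ (i : Fin 4) (k : ℤ), 1 ≤ k → 0 ≤ X i k t) →
      ∀ t ∈ Set.Icc (0 : ℝ) s, ∀ (i : Fin 4) (k : ℕ),
        (1 + ε₀) ^ (2 * (101 / 200) * (k : ℝ)) * ((1 / 2 : ℝ) * X i (k : ℤ) t ^ 2) ≤
          100 * (∑ j : Fin 4, (1 / 2 : ℝ) * X₀ j ^ 2) :=
  kpPerm_shellBound_of_chain hcyc (by linarith) (by norm_num) fun a ha =>
    dyadicGapRange_shellBarrier (lt_of_le_of_ne (hc a) (Ne.symm ha)) hε hε1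
      (α := fun i₁ i₂ i₃ μ => c a * dyadicTable i₁ i₂ i₃ μ) (fun _ _ _ _ => rfl)

/-- **`ShellBarrierAt R ε₀ (kpPermTable σ c)` for every spread `R`, every `ε₀ ∈ [1/2, 1]`, every `σ` and EVERY orbit-constant
`c`** (split at `9/16` onto `kpPermLowWide_shellBarrierAt`). MODEL lattice statement. [cite: BarbatoMorandinRomito2011, §3.2] -/
theorem kpPermGapWide_shellBarrierAt {σ : Equiv.Perm (Fin 4)} {c : Fin 4 → ℝ}
    (hcyc : ∀ a, c (σ a) = c a) :
    ∀ R : ℝ, ∀ ε₀ : ℝ, (1 : ℝ) / 2 ≤ ε₀ → ε₀ ≤ 1 → ShellBarrierAt R ε₀ (kpPermTable σ c) := by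
  intro R ε₀ hε hε1
  rcases le_or_gt ε₀ ((9 : ℝ) / 16) with h | h
  · intro _hT hO
    have hc : ∀ a, 0 ≤ c a := kpPerm_coeff_nonneg_of_orthant hO
    exact ⟨101 / 200, by norm_num, 100, by norm_num, kpPerm_shellBarrier_gapRange hcyc hc hε h⟩
  · exact kpPermLowWide_shellBarrierAt hcyc R ε₀ (by linarith) hε1

/-- **Tail ceiling for uniform KP permutation networks on `ε₀ ∈ [1/2, 1]`.** [cite: BarbatoMorandinRomito2011, §3.2] -/
theorem kpPermGapWide_ceilingAt {σ : Equiv.Perm (Fin 4)} {c : Fin 4 → ℝ} (hcyc : ∀ a, c (σ a) = c a) :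
    ∀ R : ℝ, ∀ ε₀ : ℝ, (1 : ℝ) / 2 ≤ ε₀ → ε₀ ≤ 1 → CeilingAt R ε₀ (kpPermTable σ c) := by
  intro R ε₀ hε hε1
  exact subOnsagerCeiling_ceilingAt_of_shellBarrierAt (by linarith)
    (kpPermGapWide_shellBarrierAt hcyc R ε₀ hε hε1)

/-! ## Uniform KP fan networks -/

/-- **Uniform KP fan networks, gap range `ε₀ ∈ [1/2, 9/16]`** (RUNG 10 `dyadicGapRange_shellBarrier` BY NAME through
`kpFan_shellBound_of_chain`). MODEL lattice statement. [cite: BarbatoMorandinRomito2011, §3.2] -/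
theorem kpFan_shellBarrier_gapRange {w : Fin 4 → ℝ} {ε₀ : ℝ} (hw : ∀ a, 0 ≤ w a)
    (hε : (1 : ℝ) / 2 ≤ ε₀) (hε1 : ε₀ ≤ (9 : ℝ) / 16) :
    ∀ ν : ℝ, 0 < ν → ∀ (X₀ : Fin 4 → ℝ) (s : ℝ), 0 < s → ∀ X : Fin 4 → ℤ → ℝ → ℝ,
      (∀ (i : Fin 4) (k : ℤ), X i k 0 = if k = 0 then X₀ i else 0) →
      (∀ (i : Fin 4) (k : ℤ), k < 0 → ∀ t : ℝ, X i k t = 0) →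
      (∃ M : ℝ, ∀ (t : ℝ) (i : Fin 4) (k : ℤ), (1 + (1 + ε₀) ^ ((10 : ℝ) * k)) * |X i k t| ≤ M) →
      (∀ (i : Fin 4) (k : ℤ), Continuous (X i k)) →
      (∀ (i : Fin 4) (k : ℤ), ∀ t ∈ Set.Icc (0 : ℝ) s, HasDerivWithinAt (X i k)
        (quadTerm ε₀ (kpFanTable w) X i k t - ν * (1 + ε₀) ^ ((2 : ℝ) * k) * X i k t)
        (Set.Icc (0 : ℝ) s) t) →
      (∀ t ∈ Set.Icc (0 : ℝ) s, ∀ (i : Fin 4) (k : ℤ), 1 ≤ k → 0 ≤ X i k t) →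
      ∀ t ∈ Set.Icc (0 : ℝ) s, ∀ (i : Fin 4) (k : ℕ),
        (1 + ε₀) ^ (2 * (101 / 200) * (k : ℝ)) * ((1 / 2 : ℝ) * X i (k : ℤ) t ^ 2) ≤
          100 * (∑ j : Fin 4, (1 / 2 : ℝ) * X₀ j ^ 2) := by
  intro ν hν X₀ s hs X hinit hlow hbd hcont hder hnn
  refine kpFan_shellBound_of_chain hw (by linarith) (by norm_num) (fun hW => ?_) hν hs hinit hlow hbd
    hcont hder hnn
  have hpos : 0 < ∑ j, w j ^ 2 :=
    lt_of_le_of_ne (Finset.sum_nonneg fun j _ => sq_nonneg (w j)) (Ne.symm hW)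
  exact dyadicGapRange_shellBarrier hpos hε hε1
    (α := fun i₁ i₂ i₃ μ => (∑ j, w j ^ 2) * dyadicTable i₁ i₂ i₃ μ) (fun _ _ _ _ => rfl)

/-- **`ShellBarrierAt R ε₀ (kpFanTable w)` for every spread `R`, every `ε₀ ∈ [1/2, 1]` and EVERY weight vector `w`** (split at
`9/16` onto `kpFanWide_shellBarrierAt`). MODEL lattice statement. [cite: BarbatoMorandinRomito2011, §3.2] -/
theorem kpFanGapWide_shellBarrierAt (w : Fin 4 → ℝ) :
    ∀ R : ℝ, ∀ ε₀ : ℝ, (1 : ℝ) / 2 ≤ ε₀ → ε₀ ≤ 1 → ShellBarrierAt R ε₀ (kpFanTable w) := by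
  intro R ε₀ hε hε1
  rcases le_or_gt ε₀ ((9 : ℝ) / 16) with h | h
  · intro _hT hO
    have hw : ∀ a, 0 ≤ w a := kpFan_coeff_nonneg_of_orthant hO
    exact ⟨101 / 200, by norm_num, 100, by norm_num, kpFan_shellBarrier_gapRange hw hε h⟩
  · exact kpFanWide_shellBarrierAt w R ε₀ (by linarith) hε1

/-- **Tail ceiling for uniform fan networks on `ε₀ ∈ [1/2, 1]`.** [cite: BarbatoMorandinRomito2011, §3.2] -/
theorem kpFanGapWide_ceilingAt (w : Fin 4 → ℝ) :
    ∀ R : ℝ, ∀ ε₀ : ℝ, (1 : ℝ) / 2 ≤ ε₀ → ε₀ ≤ 1 → CeilingAt R ε₀ (kpFanTable w) := by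
  intro R ε₀ hε hε1
  exact subOnsagerCeiling_ceilingAt_of_shellBarrierAt (by linarith) (kpFanGapWide_shellBarrierAt w R ε₀ hε hε1)

/-! ## The uniform 2-cycle -/

/-- **Uniform KP 2-cycle, low range `ε₀ ∈ [9/16, 31/50]`** (RUNG 4 `dyadicLowRange_shellBarrier` BY NAME through
`kpTwoCycle_shellBarrier_of_chain`). MODEL lattice statement. [cite: BarbatoMorandinRomito2011, §3.2] -/
theorem kpTwoCycle_shellBarrier_lowRange {c ε₀ : ℝ} (hc : 0 < c) (hε : (9 : ℝ) / 16 ≤ ε₀)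
    (hε1 : ε₀ ≤ (31 : ℝ) / 50) :
    ∀ ν : ℝ, 0 < ν → ∀ (X₀ : Fin 4 → ℝ) (s : ℝ), 0 < s → ∀ X : Fin 4 → ℤ → ℝ → ℝ,
      (∀ (i : Fin 4) (k : ℤ), X i k 0 = if k = 0 then X₀ i else 0) →
      (∀ (i : Fin 4) (k : ℤ), k < 0 → ∀ t : ℝ, X i k t = 0) →
      (∃ M : ℝ, ∀ (t : ℝ) (i : Fin 4) (k : ℤ), (1 + (1 + ε₀) ^ ((10 : ℝ) * k)) * |X i k t| ≤ M) →
      (∀ (i : Fin 4) (k : ℤ), Continuous (X i k)) →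
      (∀ (i : Fin 4) (k : ℤ), ∀ t ∈ Set.Icc (0 : ℝ) s, HasDerivWithinAt (X i k)
        (quadTerm ε₀ (kpTwoCycleTable c c) X i k t - ν * (1 + ε₀) ^ ((2 : ℝ) * k) * X i k t)
        (Set.Icc (0 : ℝ) s) t) →
      (∀ t ∈ Set.Icc (0 : ℝ) s, ∀ (i : Fin 4) (k : ℤ), 1 ≤ k → 0 ≤ X i k t) →
      ∀ t ∈ Set.Icc (0 : ℝ) s, ∀ (i : Fin 4) (k : ℕ),
        (1 + ε₀) ^ (2 * (101 / 200) * (k : ℝ)) * ((1 / 2 : ℝ) * X i (k : ℤ) t ^ 2) ≤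
          100 * (∑ j : Fin 4, (1 / 2 : ℝ) * X₀ j ^ 2) :=
  kpTwoCycle_shellBarrier_of_chain (by linarith) (by norm_num)
    (dyadicLowRange_shellBarrier hc hε hε1 (α := fun i₁ i₂ i₃ μ => c * dyadicTable i₁ i₂ i₃ μ)
      (fun _ _ _ _ => rfl))

/-- **Uniform KP 2-cycle, gap range `ε₀ ∈ [1/2, 9/16]`** (RUNG 10 `dyadicGapRange_shellBarrier` BY NAME through
`kpTwoCycle_shellBarrier_of_chain`). MODEL lattice statement. [cite: BarbatoMorandinRomito2011, §3.2] -/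
theorem kpTwoCycle_shellBarrier_gapRange {c ε₀ : ℝ} (hc : 0 < c) (hε : (1 : ℝ) / 2 ≤ ε₀)
    (hε1 : ε₀ ≤ (9 : ℝ) / 16) :
    ∀ ν : ℝ, 0 < ν → ∀ (X₀ : Fin 4 → ℝ) (s : ℝ), 0 < s → ∀ X : Fin 4 → ℤ → ℝ → ℝ,
      (∀ (i : Fin 4) (k : ℤ), X i k 0 = if k = 0 then X₀ i else 0) →
      (∀ (i : Fin 4) (k : ℤ), k < 0 → ∀ t : ℝ, X i k t = 0) →
      (∃ M : ℝ, ∀ (t : ℝ) (i : Fin 4) (k : ℤ), (1 + (1 + ε₀) ^ ((10 : ℝ) * k)) * |X i k t| ≤ M) →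
      (∀ (i : Fin 4) (k : ℤ), Continuous (X i k)) →
      (∀ (i : Fin 4) (k : ℤ), ∀ t ∈ Set.Icc (0 : ℝ) s, HasDerivWithinAt (X i k)
        (quadTerm ε₀ (kpTwoCycleTable c c) X i k t - ν * (1 + ε₀) ^ ((2 : ℝ) * k) * X i k t)
        (Set.Icc (0 : ℝ) s) t) →
      (∀ t ∈ Set.Icc (0 : ℝ) s, ∀ (i : Fin 4) (k : ℤ), 1 ≤ k → 0 ≤ X i k t) →
      ∀ t ∈ Set.Icc (0 : ℝ) s, ∀ (i : Fin 4) (k : ℕ),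
        (1 + ε₀) ^ (2 * (101 / 200) * (k : ℝ)) * ((1 / 2 : ℝ) * X i (k : ℤ) t ^ 2) ≤
          100 * (∑ j : Fin 4, (1 / 2 : ℝ) * X₀ j ^ 2) :=
  kpTwoCycle_shellBarrier_of_chain (by linarith) (by norm_num)
    (dyadicGapRange_shellBarrier hc hε hε1 (α := fun i₁ i₂ i₃ μ => c * dyadicTable i₁ i₂ i₃ μ)
      (fun _ _ _ _ => rfl))

/-- **`ShellBarrierAt R ε₀ (kpTwoCycleTable c c)` for every `R`, every `ε₀ ∈ [1/2, 1]`, every `c > 0`** (splits at `9/16` and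
`31/50`; above `31/50` the landed `kpTwoCycleWide_shellBarrierAt`). MODEL lattice statement. [cite: BarbatoMorandinRomito2011, §3.2] -/
theorem kpTwoCycleGapWide_shellBarrierAt {c : ℝ} (hc : 0 < c) :
    ∀ R : ℝ, ∀ ε₀ : ℝ, (1 : ℝ) / 2 ≤ ε₀ → ε₀ ≤ 1 → ShellBarrierAt R ε₀ (kpTwoCycleTable c c) := by
  intro R ε₀ hε hε1
  rcases le_or_gt ε₀ ((9 : ℝ) / 16) with h | h
  · intro _hT _hO
    exact ⟨101 / 200, by norm_num, 100, by norm_num, kpTwoCycle_shellBarrier_gapRange hc hε h⟩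
  rcases le_or_gt ε₀ ((31 : ℝ) / 50) with h2 | h2
  · intro _hT _hO
    exact ⟨101 / 200, by norm_num, 100, by norm_num, kpTwoCycle_shellBarrier_lowRange hc h.le h2⟩
  · exact kpTwoCycleWide_shellBarrierAt hc R ε₀ h2.le hε1

/-- **Tail ceiling for the uniform 2-cycle on `ε₀ ∈ [1/2, 1]`.** [cite: BarbatoMorandinRomito2011, §3.2] -/
theorem kpTwoCycleGapWide_ceilingAt {c : ℝ} (hc : 0 < c) :
    ∀ R : ℝ, ∀ ε₀ : ℝ, (1 : ℝ) / 2 ≤ ε₀ → ε₀ ≤ 1 → CeilingAt R ε₀ (kpTwoCycleTable c c) := by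
  intro R ε₀ hε hε1
  exact subOnsagerCeiling_ceilingAt_of_shellBarrierAt (by linarith)
    (kpTwoCycleGapWide_shellBarrierAt hc R ε₀ hε hε1)

end Summit.NavierStokesRegularity.NavierStokesRegularity.Theorems

end
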